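import Summits.NavierStokesRegularity.FunctionalMining.StretchingLaminateRecord
import Summits.NavierStokesRegularity.FunctionalMining.StretchingLaminateConst
import HarnessLib

/-!
# K1-Q1″: the record lamination certificate bounds `C_lam` unconditionally — `0.6395 ≤ C_lam ≤ 2/√3`

Cell `pub-nsfunc` (host summit NavierStokesRegularity, topic `FunctionalMining`), dictionary seat gen 8.
**Search for candidate a priori estimates; no regularity claim.** Six-line corollary joining (ab)
`StretchingLaminateRecord` (the bank's record tree `treeG7`, certificate `1279/2000`, 54 splits, checked by
`decide +kernel`) with (ae) `StretchingLaminateConst` (`𝒯.cert r = true → r ≤ C_lam`, no realization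
node): the laminate constant satisfies **`0.6395 ≤ C_lam ≤ 2/√3` in the kernel, unconditionally** — while
the same number bounds the FIELD constant `C⋆` only through the node (`laminate_record_le_stretchingSupConst`,
(ab)). Kept in its own module so that (ae) does not depend on the 54-split kernel computation. [ours]
-/

noncomputable section

namespace Summit.NavierStokesRegularity.FunctionalMining

namespace Laminate

/-- **`1279/2000 ≤ C_lam`, unconditionally** (record tree `treeG7`). [ours] -/
theorem record_le_laminateSupConst : (1279 / 2000 : ℝ) ≤ laminateSupConst := by
  have h := le_laminateSupConst_of_cert treeG7 (1279 / 2000) treeG7_cert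
  push_cast at h
  exact h

/-- **The unconditional kernel window for the laminate constant with the record tree:
`0.6395 ≤ C_lam ≤ 2/√3`.** [ours] -/
theorem laminateSupConst_window_record :
    (1279 / 2000 : ℝ) ≤ laminateSupConst ∧ laminateSupConst ≤ 2 / Real.sqrt 3 :=
  ⟨record_le_laminateSupConst, laminateSupConst_le_holder⟩

/-- **Reading for K1-Q1‴: if laminates are sharp then `C⋆ ≤ C_lam` and the census/bank lower bounds for
`C⋆` (`½`, kernel) sit below the laminate record: `½ ≤ C⋆ ≤ C_lam`, `0.6395 ≤ C_lam`** — sharpness alone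
does not order `C⋆` against `0.6395`. [ours; bookkeeping] -/
theorem window_of_sharp (hs : LaminatesSharp) :
    1 / 2 ≤ stretchingSupConst (d := Fin 3) ∧ stretchingSupConst (d := Fin 3) ≤ laminateSupConst ∧
      (1279 / 2000 : ℝ) ≤ laminateSupConst :=
  ⟨CellularStretching.half_le_stretchingSupConst, stretchingSupConst_le_laminateSupConst_of_sharp hs,
    record_le_laminateSupConst⟩

/-- **Both nodes ⇒ `0.6395 ≤ C⋆ = C_lam < 2/√3`.** [ours; bookkeeping] -/
theorem window_of_nodes (h : LaminateRealization) (hs : LaminatesSharp) :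
    (1279 / 2000 : ℝ) ≤ stretchingSupConst (d := Fin 3) ∧
      laminateSupConst = stretchingSupConst (d := Fin 3) ∧ laminateSupConst < 2 / Real.sqrt 3 :=
  ⟨laminate_record_le_stretchingSupConst h, laminateSupConst_eq_of_sharp h hs,
    laminateDeficit_iff.mp (laminateDeficit_of_realization h)⟩

end Laminate

end Summit.NavierStokesRegularity.FunctionalMining

end
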